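import Mathlib
import Summits.ValiantsHypothesis.ValiantsHypothesis.Theses.ForgivenCollisions

/-!
# Route ForgivenCollisions — support `GradedToUniform` (item stmt-ValiantsHypothesis-11565)

The glue step of the route: the graded collision law (`κ_r(n) ≥ n^(γ·r)` at every fixed rung `r ≥ 1`,
`γ > 0`) implies the uniform collision law (for every `c` some rung `r` has `κ_r(n) > n^c + c` for all
large `n`). Pure real-exponent bookkeeping: given `c`, pick `r ≥ 1` with `γ·r ≥ c + 1`
(Archimedes); for `n ≥ 2`, `n^c + c < 2·n^c ≤ n^(c+1) ≤ n^(γ·r) ≤ κ_r(n)`.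
-/

namespace Summit.ValiantsHypothesis.ValiantsHypothesis.Theorems

-- the mandated namespace `Summit.<Summit>.<Sub>.Theorems` has Sub = Summit here (single-conjunct summit, D-0017)
set_option linter.dupNamespace false

open Summit.ValiantsHypothesis.ValiantsHypothesis.Theses.ForgivenCollisions

/-- Elementary bookkeeping: for `2 ≤ n`, `n ^ c + c < n ^ (c + 1)`. -/
theorem gradedToUniform_pow_add_lt_pow_succ {n : ℕ} (c : ℕ) (hn : 2 ≤ n) :
    n ^ c + c < n ^ (c + 1) := by
  have hc : c < n ^ c := Nat.lt_pow_self (by omega)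
  calc n ^ c + c < n ^ c + n ^ c := by omega
    _ = 2 * n ^ c := by ring
    _ ≤ n * n ^ c := Nat.mul_le_mul_right _ hn
    _ = n ^ (c + 1) := by ring

/-- **GradedLaw → UniformLaw** (route ForgivenCollisions, support `GradedToUniform`,
item stmt-ValiantsHypothesis-11565): if some `γ > 0` gives `κ_r(n) ≥ n^(γ·r)` for every rung
`r ≥ 1` and all large `n`, then for every `c` there are `r, n₀` with `n^c + c < κ_r(n)` for all
`n ≥ n₀` — take `r = m + 1` with `(c+1)/γ ≤ m` and `n₀' = max n₀ 2`. -/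
theorem gradedToUniform_proof :
    Summit.ValiantsHypothesis.ValiantsHypothesis.Theses.ForgivenCollisions.GradedToUniform := by
  unfold GradedToUniform GradedLaw UniformLaw
  rintro ⟨γ, hγ, hG⟩ c
  -- choose the rung: `r = m + 1` with `(c + 1) / γ ≤ m`, so `1 ≤ r` and `c + 1 ≤ γ * r`
  obtain ⟨m, hm⟩ := exists_nat_ge (((c : ℝ) + 1) / γ)
  rw [div_le_iff₀ hγ] at hm
  have hγr : ((c : ℝ) + 1) ≤ γ * ((m + 1 : ℕ) : ℝ) := by
    push_cast
    nlinarith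
  obtain ⟨n₀, hn₀⟩ := hG (m + 1) (by omega)
  refine ⟨m + 1, max n₀ 2, fun n hn => ?_⟩
  have hn0 : n₀ ≤ n := le_of_max_le_left hn
  have hn2 : 2 ≤ n := le_of_max_le_right hn
  have key := hn₀ n hn0
  -- `n ^ c + c < n ^ (c + 1)` in `ℕ`
  have hlt : ((n ^ c + c : ℕ) : ℝ) < ((n ^ (c + 1) : ℕ) : ℝ) := by
    exact_mod_cast gradedToUniform_pow_add_lt_pow_succ c hn2
  -- `n ^ (c + 1) ≤ n ^ (γ * r)` as real powers, since `1 ≤ n` and `c + 1 ≤ γ * r`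
  have hpow : ((n ^ (c + 1) : ℕ) : ℝ) ≤ (n : ℝ) ^ (γ * ((m + 1 : ℕ) : ℝ)) := by
    rw [Nat.cast_pow, ← Real.rpow_natCast]
    apply Real.rpow_le_rpow_of_exponent_le
    · exact_mod_cast (show 1 ≤ n by omega)
    · push_cast at hγr ⊢
      linarith
  exact_mod_cast hlt.trans_le (hpow.trans key)

end Summit.ValiantsHypothesis.ValiantsHypothesis.Theorems
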